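/-
Copyright (c) 2026 the pub-hodgecm-mathlib formalisation cell (harness21).  Prover seat hodgecm-mathlib-K2E3-p21 (g7), HCML Track B «K2-LIT» ∕ h413
(`stmt-HodgeConjecture-24833`), line `K2_E3_EllipticInputs`, leaf (nsc-S-A′), brick (E4b-1β) MIDDLE CELL (dealer D107), shared tool file:
compact open BOX SUBGROUPS of `U_P`, `P = P_{(2,1)} ≤ GL₃(F)`, and the conjugation coordinate `u ↦ (k u k⁻¹)₁₂` (also offered to the open cell (E4b-1γ), architect K2E3-p25 (g2)).
-/
import Summits.HodgeConjecture.HodgeConjecture.Theorems.K2E3GL3BruhatCellHaar              -- ★ E3β₂: `exists_homeomorph_unipotentRadicalGL_twoOne`, `mul_apply_of_mem_upperUnitriangular`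
import Summits.HodgeConjecture.HodgeConjecture.Theorems.K2E3GL3BruhatCellFunctionals       -- ★ E3β₃: `conj_mem_unipotentRadicalGL_of_mem_parabolic`
import Summits.HodgeConjecture.HodgeConjecture.Theorems.K2E3GL3MaximalParabolicRelabel     -- ★ `unipotentRadicalGL_eq_bool`, `mem_standardParabolicGL_iff_entry`
import Literature.NumberTheory.Automorphic.HeckeTransversalGL                               -- ★ `glInt`, `valuation_apply_le_one_of_mem_glInt`, `valuation_det_eq_one_of_mem_glInt`
import Literature.NumberTheory.Automorphic.JacquetModuleProofs                              -- ★ `isOpen_setOf_valuation_le`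
import HarnessLib

/-!
# K2_E3 road (h413), leaf (nsc-S-A′), brick (E4b-1β) tool — BOX SUBGROUPS `K_R = x₁₂(𝔟_R)·x₀₂(𝔟_R) ≤ U_P` AND THE COORDINATE `u ↦ (k u k⁻¹)₁₂`

Cell `pub/hodgecm-mathlib` (D-0151), Track B, seat K2E3-p21 (g7).  `--supports stmt-HodgeConjecture-24833 --as helper`; THEOREMS ONLY; COUNT-NEUTRAL.

THE MATHEMATICS ([BernsteinZelevinsky1977, §2.3, §5 (5.14)]; [Casselman1995, Prop. 1.4.4, §6.3]).  `U = U_P ≅ F²` (`(y,z) ↦ x₁₂(y) x₀₂(z)`, ★ `exists_homeomorph_unipotentRadicalGL_twoOne`),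
the closed ball `𝔟_R = {|x| ≤ R}` is a compact open additive subgroup of `F`, and
* §1 **`exists_ballAddSubgroup`**, **`exists_boxSubgroup (R ≠ 0) : ∃ K ≤ U, compact, open, u ∈ K ↔ |u₁₂| ≤ R ∧ |u₀₂| ≤ R`**;
* §2 **the conjugation coordinate** `ℓ_k(u) = (k u k⁻¹)₁₂` for `k ∈ P`: `ℓ_k(u)·k₂₂ = k₁₀ u₀₂ + k₁₁ u₁₂` (`conj_apply_one_two_mul`), additive in `u` (`conj_apply_one_two_mul_mul`), continuous;
* §3 **for integral `k`** (`k ∈ P ∩ GL₃(𝒪)`: `|kᵢⱼ| ≤ 1`, `|k₂₂| = 1`, `max(|k₁₀|,|k₁₁|) = 1`): **`image_conj_one_two_boxSubgroup : ℓ_k '' K = 𝔟_R`** — the image is the SAME ball for all integral `k`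
  (the uniformity behind the single averaging subgroup of the middle-cell kernel, file 3b).

HONEST LABEL: HC_CM is proved only modulo the 7 printed citations (2 remaining named inputs: hLiu418 = stmt-HodgeConjecture-24832, h413 = stmt-HodgeConjecture-24833) until
rung 0 closes; count-neutral helper.

## Mathlib ∕ tree search
Mathlib `IsNonarchimedeanLocalField.isCompact_closedBall`, `Valuation.map_add`, `Homeomorph.isOpenMap` · ★ `isOpen_setOf_valuation_le` · ★ `exists_homeomorph_unipotentRadicalGL_twoOne`, `coord_apply`,
`mul_apply_of_mem_upperUnitriangular`, `mem_upperUnitriangular_three_iff`, `conj_mem_unipotentRadicalGL_of_mem_parabolic`, `unipotentRadicalGL_eq_bool`, `mem_standardParabolicGL_iff_entry`,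
`valuation_apply_le_one_of_mem_glInt`, `valuation_det_eq_one_of_mem_glInt`.  Dedup: `lean search 'boxSubgroup|conj_apply_one_two'` — none.

## References
* [BernsteinZelevinsky1977] I. N. Bernstein, A. V. Zelevinsky, *Induced representations of reductive p-adic groups I*, Ann. Sci. ÉNS 10 (1977), §2.3, §5 (5.14).
* [Casselman1995] W. Casselman, *Introduction to the theory of admissible representations of p-adic reductive groups* (draft 1995), Prop. 1.4.4, §6.3.
-/

set_option autoImplicit false
set_option linter.dupNamespace false

noncomputable section

open Set Function
open scoped MatrixGroups

namespace Summit.HodgeConjecture.HodgeConjecture.Cruxes.H413.K2E3GL3UnipotentRadicalBoxSubgroup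

open Literature.NumberTheory.Automorphic ValuativeRel
open Literature.NumberTheory.GaloisRepresentations Literature.NumberTheory.GaloisRepresentations.IsNonarchimedeanLocalField
open Summit.HodgeConjecture.HodgeConjecture.Cruxes.H413.K2E3GL3BruhatCellSubgroups
open Summit.HodgeConjecture.HodgeConjecture.Cruxes.H413.K2E3GL3BruhatCellHaar
open Summit.HodgeConjecture.HodgeConjecture.Cruxes.H413.K2E3GL3BruhatCellFunctionals

variable {F : Type} [Field F] [ValuativeRel F] [TopologicalSpace F] [IsNonarchimedeanLocalField F]

/-! ## §1 The closed ball as an additive subgroup; the box subgroups of `U_P` -/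

omit [TopologicalSpace F] [IsNonarchimedeanLocalField F] in
/-- The closed ball `𝔟_R = {x : |x| ≤ R}` is an additive subgroup of `F` (ultrametric inequality). [cite: Casselman1995, Prop. 1.4.4] -/
theorem exists_ballAddSubgroup (R : ValueGroupWithZero F) : ∃ L : AddSubgroup F, (L : Set F) = {x : F | valuation F x ≤ R} :=
  ⟨{ carrier := {x : F | valuation F x ≤ R}
     add_mem' := fun {a b} ha hb => by
       simp only [mem_setOf_eq] at ha hb ⊢
       exact (Valuation.map_add _ a b).trans (max_le ha hb)
     zero_mem' := by simp
     neg_mem' := fun {a} ha => by simpa only [mem_setOf_eq, Valuation.map_neg] using ha }, rfl⟩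

variable (e : (F × F) × F ≃ₜ ↥(unipotentRadicalGL F (id : Fin 3 → Fin 3)))
  (he : ∀ p : (F × F) × F, (((e p : ↥(unipotentRadicalGL F (id : Fin 3 → Fin 3))) : GL (Fin 3) F) : Matrix (Fin 3) (Fin 3) F) = !![1, p.1.1, p.2; 0, 1, p.1.2; 0, 0, 1])
include he

/-- **THE BOX SUBGROUPS OF `U_P`.**  For `R ≠ 0` there is a compact open subgroup `K_R ≤ U_P = U_{(2,1)}` with `u ∈ K_R ↔ |u₁₂| ≤ R ∧ |u₀₂| ≤ R` — the image of `𝔟_R × 𝔟_R` under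
`(y,z) ↦ x₁₂(y)x₀₂(z)` (★ `exists_homeomorph_unipotentRadicalGL_twoOne`, additive). [cite: BernsteinZelevinsky1977, §2.3] [cite: Casselman1995, Prop. 1.4.4] -/
theorem exists_boxSubgroup {R : ValueGroupWithZero F} (hR : R ≠ 0) :
    ∃ K : Subgroup ↥(unipotentRadicalGL F (![false, false, true] : Fin 3 → Bool)), IsCompact (K : Set ↥(unipotentRadicalGL F (![false, false, true] : Fin 3 → Bool))) ∧ IsOpen (K : Set ↥(unipotentRadicalGL F (![false, false, true] : Fin 3 → Bool))) ∧
      ∀ u : ↥(unipotentRadicalGL F (![false, false, true] : Fin 3 → Bool)), u ∈ K ↔ valuation F (((u : GL (Fin 3) F) : Matrix (Fin 3) (Fin 3) F) 1 2) ≤ R ∧ valuation F (((u : GL (Fin 3) F) : Matrix (Fin 3) (Fin 3) F) 0 2) ≤ R := by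
  haveI : IsTopologicalRing F := inferInstance
  obtain ⟨φ, hφ, hφadd⟩ := exists_homeomorph_unipotentRadicalGL_twoOne e he
  -- entries of `φ q`
  have hφ12 : ∀ q : F × F, (((φ q : ↥(unipotentRadicalGL F (![false, false, true] : Fin 3 → Bool))) : GL (Fin 3) F) : Matrix (Fin 3) (Fin 3) F) 1 2 = q.1 := fun q => by
    rw [hφ]; exact (coord_apply e he _).2.1
  have hφ02 : ∀ q : F × F, (((φ q : ↥(unipotentRadicalGL F (![false, false, true] : Fin 3 → Bool))) : GL (Fin 3) F) : Matrix (Fin 3) (Fin 3) F) 0 2 = q.2 := fun q => by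
    rw [hφ]; exact (coord_apply e he _).2.2
  have hφ0 : φ 0 = 1 := by
    have h := hφadd 0 0
    rw [add_zero] at h
    exact left_eq_mul.1 h
  have hφneg : ∀ a : F × F, φ (-a) = (φ a)⁻¹ := fun a => by
    rw [eq_inv_iff_mul_eq_one, ← hφadd, neg_add_cancel, hφ0]
  -- the carrier in coordinates
  have hmem : ∀ u : ↥(unipotentRadicalGL F (![false, false, true] : Fin 3 → Bool)), (valuation F (((u : GL (Fin 3) F) : Matrix (Fin 3) (Fin 3) F) 1 2) ≤ R ∧ valuation F (((u : GL (Fin 3) F) : Matrix (Fin 3) (Fin 3) F) 0 2) ≤ R) ↔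
      u ∈ φ '' ({x : F | valuation F x ≤ R} ×ˢ {x : F | valuation F x ≤ R}) := fun u => by
    constructor
    · rintro ⟨h1, h2⟩
      refine ⟨φ.symm u, ⟨?_, ?_⟩, φ.apply_symm_apply u⟩
      · simpa only [mem_setOf_eq, ← hφ12 (φ.symm u), Homeomorph.apply_symm_apply] using h1
      · simpa only [mem_setOf_eq, ← hφ02 (φ.symm u), Homeomorph.apply_symm_apply] using h2
    · rintro ⟨q, ⟨hq1, hq2⟩, rfl⟩
      exact ⟨by rw [hφ12]; exact hq1, by rw [hφ02]; exact hq2⟩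
  have hmul : ∀ {u v : ↥(unipotentRadicalGL F (![false, false, true] : Fin 3 → Bool))}, u ∈ {u : ↥(unipotentRadicalGL F (![false, false, true] : Fin 3 → Bool)) | valuation F (((u : GL (Fin 3) F) : Matrix (Fin 3) (Fin 3) F) 1 2) ≤ R ∧ valuation F (((u : GL (Fin 3) F) : Matrix (Fin 3) (Fin 3) F) 0 2) ≤ R} →
      v ∈ {u : ↥(unipotentRadicalGL F (![false, false, true] : Fin 3 → Bool)) | valuation F (((u : GL (Fin 3) F) : Matrix (Fin 3) (Fin 3) F) 1 2) ≤ R ∧ valuation F (((u : GL (Fin 3) F) : Matrix (Fin 3) (Fin 3) F) 0 2) ≤ R} →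
      u * v ∈ {u : ↥(unipotentRadicalGL F (![false, false, true] : Fin 3 → Bool)) | valuation F (((u : GL (Fin 3) F) : Matrix (Fin 3) (Fin 3) F) 1 2) ≤ R ∧ valuation F (((u : GL (Fin 3) F) : Matrix (Fin 3) (Fin 3) F) 0 2) ≤ R} := by
    intro u v hu hv
    obtain ⟨a, rfl⟩ := φ.surjective u
    obtain ⟨b, rfl⟩ := φ.surjective v
    rw [mem_setOf_eq, hφ12, hφ02] at hu hv
    rw [mem_setOf_eq, ← hφadd, hφ12, hφ02, Prod.fst_add, Prod.snd_add]
    exact ⟨(Valuation.map_add _ _ _).trans (max_le hu.1 hv.1), (Valuation.map_add _ _ _).trans (max_le hu.2 hv.2)⟩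
  have hone : (1 : ↥(unipotentRadicalGL F (![false, false, true] : Fin 3 → Bool))) ∈ {u : ↥(unipotentRadicalGL F (![false, false, true] : Fin 3 → Bool)) | valuation F (((u : GL (Fin 3) F) : Matrix (Fin 3) (Fin 3) F) 1 2) ≤ R ∧ valuation F (((u : GL (Fin 3) F) : Matrix (Fin 3) (Fin 3) F) 0 2) ≤ R} := by
    rw [mem_setOf_eq, ← hφ0, hφ12, hφ02, Prod.fst_zero, Prod.snd_zero, map_zero]
    exact ⟨zero_le, zero_le⟩
  have hinv : ∀ {u : ↥(unipotentRadicalGL F (![false, false, true] : Fin 3 → Bool))}, u ∈ {u : ↥(unipotentRadicalGL F (![false, false, true] : Fin 3 → Bool)) | valuation F (((u : GL (Fin 3) F) : Matrix (Fin 3) (Fin 3) F) 1 2) ≤ R ∧ valuation F (((u : GL (Fin 3) F) : Matrix (Fin 3) (Fin 3) F) 0 2) ≤ R} →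
      u⁻¹ ∈ {u : ↥(unipotentRadicalGL F (![false, false, true] : Fin 3 → Bool)) | valuation F (((u : GL (Fin 3) F) : Matrix (Fin 3) (Fin 3) F) 1 2) ≤ R ∧ valuation F (((u : GL (Fin 3) F) : Matrix (Fin 3) (Fin 3) F) 0 2) ≤ R} := by
    intro u hu
    obtain ⟨a, rfl⟩ := φ.surjective u
    rw [mem_setOf_eq, hφ12, hφ02] at hu
    rw [mem_setOf_eq, ← hφneg, hφ12, hφ02, Prod.fst_neg, Prod.snd_neg, Valuation.map_neg, Valuation.map_neg]
    exact hu
  let K : Subgroup ↥(unipotentRadicalGL F (![false, false, true] : Fin 3 → Bool)) :=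
    { carrier := {u : ↥(unipotentRadicalGL F (![false, false, true] : Fin 3 → Bool)) | valuation F (((u : GL (Fin 3) F) : Matrix (Fin 3) (Fin 3) F) 1 2) ≤ R ∧ valuation F (((u : GL (Fin 3) F) : Matrix (Fin 3) (Fin 3) F) 0 2) ≤ R}
      mul_mem' := hmul
      one_mem' := hone
      inv_mem' := hinv }
  have hset : (K : Set ↥(unipotentRadicalGL F (![false, false, true] : Fin 3 → Bool))) = φ '' ({x : F | valuation F x ≤ R} ×ˢ {x : F | valuation F x ≤ R}) := Set.ext fun u => hmem u
  refine ⟨K, ?_, ?_, fun u => Iff.rfl⟩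
  · rw [hset]
    exact ((IsNonarchimedeanLocalField.isCompact_closedBall F R).prod (IsNonarchimedeanLocalField.isCompact_closedBall F R)).image φ.continuous
  · rw [hset]
    exact φ.isOpenMap _ ((DeltaCharBorel.isOpen_setOf_valuation_le hR).prod (DeltaCharBorel.isOpen_setOf_valuation_le hR))

/-! ## §2 The conjugation coordinate `ℓ_k(u) = (k u k⁻¹)₁₂`, `k ∈ P_{(2,1)}` -/

omit [ValuativeRel F] [TopologicalSpace F] [IsNonarchimedeanLocalField F] he in
/-- For `k ∈ P_{(2,1)}` and `u ∈ U_P`: `k u k⁻¹ ∈ U_P` (normality, in the `Bool` labelling). [cite: BernsteinZelevinsky1977, §2.3] -/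
theorem conj_mem {k : GL (Fin 3) F} (hk : k ∈ (standardParabolicGL F (![0, 0, 1] : Fin 3 → Fin 2))) (u : ↥(unipotentRadicalGL F (![false, false, true] : Fin 3 → Bool))) : k * (u : GL (Fin 3) F) * k⁻¹ ∈ (unipotentRadicalGL F (![false, false, true] : Fin 3 → Bool)) := by
  have hu : (u : GL (Fin 3) F) ∈ unipotentRadicalGL F (![0, 0, 1] : Fin 3 → Fin 2) := by rw [K2E3GL3MaximalParabolicRelabel.unipotentRadicalGL_eq_bool]; exact u.2
  have h := conj_mem_unipotentRadicalGL_of_mem_parabolic (![0, 0, 1] : Fin 3 → Fin 2) hk hu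
  rwa [K2E3GL3MaximalParabolicRelabel.unipotentRadicalGL_eq_bool] at h

omit [ValuativeRel F] [TopologicalSpace F] [IsNonarchimedeanLocalField F] he in
/-- **The conjugation coordinate**: for `k ∈ P_{(2,1)}` and `u ∈ U_P`, `(k u k⁻¹)₁₂ · k₂₂ = k₁₀ u₀₂ + k₁₁ u₁₂` (compare the `(1,2)` entries of `(k u k⁻¹)·k = k·u`).
[cite: BernsteinZelevinsky1977, §2.3] -/
theorem conj_apply_one_two_mul {k : GL (Fin 3) F} (hk : k ∈ (standardParabolicGL F (![0, 0, 1] : Fin 3 → Fin 2))) (u : ↥(unipotentRadicalGL F (![false, false, true] : Fin 3 → Bool))) :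
    ((k * (u : GL (Fin 3) F) * k⁻¹ : GL (Fin 3) F) : Matrix (Fin 3) (Fin 3) F) 1 2 * ((k : Matrix (Fin 3) (Fin 3) F) 2 2) =
      ((k : Matrix (Fin 3) (Fin 3) F) 1 0) * (((u : GL (Fin 3) F) : Matrix (Fin 3) (Fin 3) F) 0 2) + ((k : Matrix (Fin 3) (Fin 3) F) 1 1) * (((u : GL (Fin 3) F) : Matrix (Fin 3) (Fin 3) F) 1 2) := by
  obtain ⟨hcU, hc01⟩ := (mem_unipotentRadicalGL_twoOne_iff _).1 (conj_mem hk u)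
  obtain ⟨huU, hu01⟩ := (mem_unipotentRadicalGL_twoOne_iff _).1 u.2
  have hcm := (mem_upperUnitriangular_three_iff _).1 hcU
  have hum := (mem_upperUnitriangular_three_iff _).1 huU
  obtain ⟨h20, h21⟩ := (K2E3GL3MaximalParabolicRelabel.mem_standardParabolicGL_iff_entry k).1 hk
  have hprod : ((k * (u : GL (Fin 3) F) * k⁻¹ : GL (Fin 3) F) : Matrix (Fin 3) (Fin 3) F) * (k : Matrix (Fin 3) (Fin 3) F) = (k : Matrix (Fin 3) (Fin 3) F) * ((u : GL (Fin 3) F) : Matrix (Fin 3) (Fin 3) F) := by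
    rw [← Units.val_mul, ← Units.val_mul, inv_mul_cancel_right]
  have h12 := congrArg (fun M : Matrix (Fin 3) (Fin 3) F => M 1 2) hprod
  simp only [Matrix.mul_apply, Fin.sum_univ_three] at h12
  -- `h12 : c₁₀ k₀₂ + c₁₁ k₁₂ + ℓ k₂₂ = k₁₀ u₀₂ + k₁₁ u₁₂ + k₁₂ u₂₂` with `c₁₀ = 0`, `c₁₁ = 1`, `u₂₂ = 1`
  linear_combination h12 - (k : Matrix (Fin 3) (Fin 3) F) 1 2 * hcm.2.2.2.2.1 + (k : Matrix (Fin 3) (Fin 3) F) 1 2 * hum.2.2.2.2.2 -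
    (k : Matrix (Fin 3) (Fin 3) F) 0 2 * hcm.1

omit [ValuativeRel F] [TopologicalSpace F] [IsNonarchimedeanLocalField F] he in
/-- `ℓ_k` is additive on `U_P`: `(k (u v) k⁻¹)₁₂ = (k u k⁻¹)₁₂ + (k v k⁻¹)₁₂`. [cite: BernsteinZelevinsky1977, §2.3] -/
theorem conj_apply_one_two_mul_mul {k : GL (Fin 3) F} (hk : k ∈ (standardParabolicGL F (![0, 0, 1] : Fin 3 → Fin 2))) (u v : ↥(unipotentRadicalGL F (![false, false, true] : Fin 3 → Bool))) :
    ((k * ((u * v : ↥(unipotentRadicalGL F (![false, false, true] : Fin 3 → Bool))) : GL (Fin 3) F) * k⁻¹ : GL (Fin 3) F) : Matrix (Fin 3) (Fin 3) F) 1 2 =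
      ((k * (u : GL (Fin 3) F) * k⁻¹ : GL (Fin 3) F) : Matrix (Fin 3) (Fin 3) F) 1 2 + ((k * (v : GL (Fin 3) F) * k⁻¹ : GL (Fin 3) F) : Matrix (Fin 3) (Fin 3) F) 1 2 := by
  have hu := ((mem_unipotentRadicalGL_twoOne_iff _).1 (conj_mem hk u)).1
  have hv := ((mem_unipotentRadicalGL_twoOne_iff _).1 (conj_mem hk v)).1
  have hsplit : k * ((u * v : ↥(unipotentRadicalGL F (![false, false, true] : Fin 3 → Bool))) : GL (Fin 3) F) * k⁻¹ = (k * (u : GL (Fin 3) F) * k⁻¹) * (k * (v : GL (Fin 3) F) * k⁻¹) := by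
    rw [Subgroup.coe_mul]; group
  rw [hsplit]
  exact (mul_apply_of_mem_upperUnitriangular hu hv).2.1

omit [ValuativeRel F] [IsNonarchimedeanLocalField F] he in
/-- `ℓ_k` is continuous. [folklore] -/
theorem continuous_conj_apply_one_two [IsTopologicalRing F] (k : GL (Fin 3) F) :
    Continuous fun u : ↥(unipotentRadicalGL F (![false, false, true] : Fin 3 → Bool)) => ((k * (u : GL (Fin 3) F) * k⁻¹ : GL (Fin 3) F) : Matrix (Fin 3) (Fin 3) F) 1 2 :=
  (Units.continuous_val.comp ((continuous_const.mul continuous_subtype_val).mul continuous_const)).matrix_elem 1 2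

/-! ## §3 Integral `k`: `|k₂₂| = 1`, `max(|k₁₀|,|k₁₁|) = 1`, and `ℓ_k(K_R) = 𝔟_R` -/

omit [TopologicalSpace F] [IsNonarchimedeanLocalField F] he in
/-- For `k ∈ P_{(2,1)} ∩ GL₃(𝒪)`: `|k₂₂| = 1` and `|k₁₀|, |k₁₁|` are not both `< 1` (`det k = (k₀₀k₁₁ − k₀₁k₁₀)·k₂₂` is a unit with integral factors).
[cite: BernsteinZelevinsky1977, §5 (5.14)] -/
theorem valuation_entries_of_mem_glInt {k : GL (Fin 3) F} (hk : k ∈ (standardParabolicGL F (![0, 0, 1] : Fin 3 → Fin 2))) (hkO : k ∈ glInt 3 F) :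
    valuation F ((k : Matrix (Fin 3) (Fin 3) F) 2 2) = 1 ∧ ¬ (valuation F ((k : Matrix (Fin 3) (Fin 3) F) 1 0) < 1 ∧ valuation F ((k : Matrix (Fin 3) (Fin 3) F) 1 1) < 1) := by
  have hle := valuation_apply_le_one_of_mem_glInt hkO
  obtain ⟨h20, h21⟩ := (K2E3GL3MaximalParabolicRelabel.mem_standardParabolicGL_iff_entry k).1 hk
  have hdet : ((Matrix.GeneralLinearGroup.det k : Fˣ) : F) = (((k : Matrix (Fin 3) (Fin 3) F) 0 0) * ((k : Matrix (Fin 3) (Fin 3) F) 1 1) - ((k : Matrix (Fin 3) (Fin 3) F) 0 1) * ((k : Matrix (Fin 3) (Fin 3) F) 1 0)) * ((k : Matrix (Fin 3) (Fin 3) F) 2 2) := by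
    rw [Matrix.GeneralLinearGroup.val_det_apply, Matrix.det_fin_three, h20, h21]; ring
  have h1 : valuation F (((k : Matrix (Fin 3) (Fin 3) F) 0 0) * ((k : Matrix (Fin 3) (Fin 3) F) 1 1) - ((k : Matrix (Fin 3) (Fin 3) F) 0 1) * ((k : Matrix (Fin 3) (Fin 3) F) 1 0)) * valuation F ((k : Matrix (Fin 3) (Fin 3) F) 2 2) = 1 := by
    rw [← map_mul, ← hdet]; exact valuation_det_eq_one_of_mem_glInt hkO
  have hA : valuation F (((k : Matrix (Fin 3) (Fin 3) F) 0 0) * ((k : Matrix (Fin 3) (Fin 3) F) 1 1) - ((k : Matrix (Fin 3) (Fin 3) F) 0 1) * ((k : Matrix (Fin 3) (Fin 3) F) 1 0)) ≤ 1 := by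
    refine (Valuation.map_sub _ _ _).trans (max_le ?_ ?_)
    · rw [map_mul]; exact mul_le_one' (hle 0 0) (hle 1 1)
    · rw [map_mul]; exact mul_le_one' (hle 0 1) (hle 1 0)
  refine ⟨le_antisymm (hle 2 2) ?_, fun hlt => ?_⟩
  · by_contra hlt
    push Not at hlt
    have : valuation F (((k : Matrix (Fin 3) (Fin 3) F) 0 0) * ((k : Matrix (Fin 3) (Fin 3) F) 1 1) - ((k : Matrix (Fin 3) (Fin 3) F) 0 1) * ((k : Matrix (Fin 3) (Fin 3) F) 1 0)) * valuation F ((k : Matrix (Fin 3) (Fin 3) F) 2 2) < 1 := by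
      calc _ ≤ 1 * valuation F ((k : Matrix (Fin 3) (Fin 3) F) 2 2) := mul_le_mul_left hA _
        _ < 1 := by rw [one_mul]; exact hlt
    exact absurd h1 (ne_of_lt this)
  · have hA' : valuation F (((k : Matrix (Fin 3) (Fin 3) F) 0 0) * ((k : Matrix (Fin 3) (Fin 3) F) 1 1) - ((k : Matrix (Fin 3) (Fin 3) F) 0 1) * ((k : Matrix (Fin 3) (Fin 3) F) 1 0)) < 1 := by
      refine lt_of_le_of_lt (Valuation.map_sub _ _ _) (max_lt ?_ ?_)
      · rw [map_mul]
        calc _ ≤ 1 * valuation F ((k : Matrix (Fin 3) (Fin 3) F) 1 1) := mul_le_mul_left (hle 0 0) _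
          _ < 1 := by rw [one_mul]; exact hlt.2
      · rw [map_mul]
        calc _ ≤ 1 * valuation F ((k : Matrix (Fin 3) (Fin 3) F) 1 0) := mul_le_mul_left (hle 0 1) _
          _ < 1 := by rw [one_mul]; exact hlt.1
    have : valuation F (((k : Matrix (Fin 3) (Fin 3) F) 0 0) * ((k : Matrix (Fin 3) (Fin 3) F) 1 1) - ((k : Matrix (Fin 3) (Fin 3) F) 0 1) * ((k : Matrix (Fin 3) (Fin 3) F) 1 0)) * valuation F ((k : Matrix (Fin 3) (Fin 3) F) 2 2) < 1 :=
      calc _ ≤ valuation F (((k : Matrix (Fin 3) (Fin 3) F) 0 0) * ((k : Matrix (Fin 3) (Fin 3) F) 1 1) - ((k : Matrix (Fin 3) (Fin 3) F) 0 1) * ((k : Matrix (Fin 3) (Fin 3) F) 1 0)) * 1 := mul_le_mul_right (hle 2 2) _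
        _ < 1 := by rw [mul_one]; exact hA'
    exact absurd h1 (ne_of_lt this)

omit [IsNonarchimedeanLocalField F] in
/-- **`ℓ_k(K_R) = 𝔟_R` FOR INTEGRAL `k`.**  For `k ∈ P_{(2,1)} ∩ GL₃(𝒪)` and the box subgroup `K_R` (§1): the image of `K_R` under `u ↦ (k u k⁻¹)₁₂` is exactly the ball `{|x| ≤ R}`
(`⊆`: ultrametric; `⊇`: one of `k₁₀, k₁₁` is a unit — solve with `u = x₀₂(z)` or `x₁₂(y)`).  In particular it is OPEN and the SAME for all integral `k`. [cite: BernsteinZelevinsky1977, §5 (5.14)] -/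
theorem image_conj_one_two_boxSubgroup [IsTopologicalRing F] {R : ValueGroupWithZero F} {K : Subgroup ↥(unipotentRadicalGL F (![false, false, true] : Fin 3 → Bool))}
    (hK : ∀ u : ↥(unipotentRadicalGL F (![false, false, true] : Fin 3 → Bool)), u ∈ K ↔ valuation F (((u : GL (Fin 3) F) : Matrix (Fin 3) (Fin 3) F) 1 2) ≤ R ∧ valuation F (((u : GL (Fin 3) F) : Matrix (Fin 3) (Fin 3) F) 0 2) ≤ R)
    {k : GL (Fin 3) F} (hk : k ∈ (standardParabolicGL F (![0, 0, 1] : Fin 3 → Fin 2))) (hkO : k ∈ glInt 3 F) :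
    (fun u : ↥(unipotentRadicalGL F (![false, false, true] : Fin 3 → Bool)) => ((k * (u : GL (Fin 3) F) * k⁻¹ : GL (Fin 3) F) : Matrix (Fin 3) (Fin 3) F) 1 2) '' (K : Set ↥(unipotentRadicalGL F (![false, false, true] : Fin 3 → Bool))) = {x : F | valuation F x ≤ R} := by
  obtain ⟨φ, hφ, -⟩ := exists_homeomorph_unipotentRadicalGL_twoOne e he
  have hφ12 : ∀ q : F × F, (((φ q : ↥(unipotentRadicalGL F (![false, false, true] : Fin 3 → Bool))) : GL (Fin 3) F) : Matrix (Fin 3) (Fin 3) F) 1 2 = q.1 := fun q => by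
    rw [hφ]; exact (coord_apply e he _).2.1
  have hφ02 : ∀ q : F × F, (((φ q : ↥(unipotentRadicalGL F (![false, false, true] : Fin 3 → Bool))) : GL (Fin 3) F) : Matrix (Fin 3) (Fin 3) F) 0 2 = q.2 := fun q => by
    rw [hφ]; exact (coord_apply e he _).2.2
  have hle := valuation_apply_le_one_of_mem_glInt hkO
  obtain ⟨h22, hrow⟩ := valuation_entries_of_mem_glInt hk hkO
  have hk22 : ((k : Matrix (Fin 3) (Fin 3) F) 2 2) ≠ 0 := fun h => by rw [h, map_zero] at h22; exact zero_ne_one h22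
  -- the coordinate in closed form
  have hℓ : ∀ u : ↥(unipotentRadicalGL F (![false, false, true] : Fin 3 → Bool)), ((k * (u : GL (Fin 3) F) * k⁻¹ : GL (Fin 3) F) : Matrix (Fin 3) (Fin 3) F) 1 2 =
      (((k : Matrix (Fin 3) (Fin 3) F) 1 0) * (((u : GL (Fin 3) F) : Matrix (Fin 3) (Fin 3) F) 0 2) + ((k : Matrix (Fin 3) (Fin 3) F) 1 1) * (((u : GL (Fin 3) F) : Matrix (Fin 3) (Fin 3) F) 1 2)) / ((k : Matrix (Fin 3) (Fin 3) F) 2 2) := fun u => by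
    rw [eq_div_iff hk22]; exact conj_apply_one_two_mul hk u
  refine Set.Subset.antisymm ?_ fun x hx => ?_
  · rintro _ ⟨u, hu, rfl⟩
    obtain ⟨hu1, hu2⟩ := (hK u).1 hu
    simp only [mem_setOf_eq, hℓ, map_div₀, h22, div_one]
    refine (Valuation.map_add _ _ _).trans (max_le ?_ ?_)
    · rw [map_mul]; exact (mul_le_mul' (hle 1 0) hu2).trans_eq (one_mul R)
    · rw [map_mul]; exact (mul_le_mul' (hle 1 1) hu1).trans_eq (one_mul R)
  · rw [mem_setOf_eq] at hx
    by_cases h11 : valuation F ((k : Matrix (Fin 3) (Fin 3) F) 1 1) < 1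
    · -- then `k₁₀` is a unit: use `u = x₀₂(x k₂₂ ∕ k₁₀)`
      have h10 : valuation F ((k : Matrix (Fin 3) (Fin 3) F) 1 0) = 1 := (hle 1 0).eq_or_lt.resolve_right fun h => hrow ⟨h, h11⟩
      have hk10 : ((k : Matrix (Fin 3) (Fin 3) F) 1 0) ≠ 0 := fun h => by rw [h, map_zero] at h10; exact zero_ne_one h10
      refine ⟨φ (0, x * ((k : Matrix (Fin 3) (Fin 3) F) 2 2) / ((k : Matrix (Fin 3) (Fin 3) F) 1 0)), (hK _).2 ⟨?_, ?_⟩, ?_⟩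
      · rw [hφ12, map_zero]; exact zero_le
      · rw [hφ02, map_div₀, map_mul, h22, h10, mul_one, div_one]; exact hx
      · simp only [hℓ, hφ12, hφ02, mul_zero, add_zero]
        field_simp
    · push Not at h11
      have h11' : valuation F ((k : Matrix (Fin 3) (Fin 3) F) 1 1) = 1 := le_antisymm (hle 1 1) h11
      have hk11 : ((k : Matrix (Fin 3) (Fin 3) F) 1 1) ≠ 0 := fun h => by rw [h, map_zero] at h11'; exact zero_ne_one h11'
      refine ⟨φ (x * ((k : Matrix (Fin 3) (Fin 3) F) 2 2) / ((k : Matrix (Fin 3) (Fin 3) F) 1 1), 0), (hK _).2 ⟨?_, ?_⟩, ?_⟩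
      · rw [hφ12, map_div₀, map_mul, h22, h11', mul_one, div_one]; exact hx
      · rw [hφ02, map_zero]; exact zero_le
      · simp only [hℓ, hφ12, hφ02, mul_zero, zero_add]
        field_simp

end Summit.HodgeConjecture.HodgeConjecture.Cruxes.H413.K2E3GL3UnipotentRadicalBoxSubgroup

end
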